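import Summits.BirchSwinnertonDyer.BirchSwinnertonDyer.Theorems.PrintCf2SplitBadTwoTowerTorsionSharp
import Summits.BirchSwinnertonDyer.BirchSwinnertonDyer.Theorems.PrintCf2SplitBadTwoCMTwoTorsionField
import HarnessLib

/-!
# Crux `PrintCf2.SplitBadTwoRankOneOfFacts` (stmt-BirchSwinnertonDyer-20368), road α v9.1 — S3c₂ pieces (ii)-b/(iii), brick B16 file 1:
# the INERTIA-FIXED part of the CM summand is `W*[2]` at EVERY additive `w ∤ 2`; a `K`-rational `π` pins `√−7 ∈ K`

Cell `bsd-print-cf2`, width seat `bsd-line-cf2-p1-w3` g7 (prover-bsd-line-cf2-p1-w3-g7-0); `--supports stmt-BirchSwinnertonDyer-20368`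
(helper, Theses-free). HONEST FRAMING: nothing here closes the crux or a registered stub; BSD is not proved by any of this; no summit
statement is proved by this seat. No definition, no named fact, no `sorry`.

CONTEXT. The registered stub S3c₂ `stub_restrictedEulerCharBottom_two` (skeleton of record v9.1 fc726a893a021e04) is the control +
bottom evaluation of Agboola's restricted Selmer group `𝔖_{v̄}(K*_∞, W*)`, `W* = ↥((W.baseChange K).endEigenPrimaryTorsion 2 π r)`, along
the `ℤ₂`-line `κ'` of `K` unramified outside `v̄`. LEAD g11 landed the KERNEL side (`#W*(K*_∞) = 2`, `v₂ #ker(control) ≤ 1`: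
`…TowerTorsionSharp`, p656507, with a `θ² = −7` binder). This file (brick B16 «local cokernel kernels of control at `w ∤ 2`»,
file 1 = the local INPUT) proves the inertia-level statement that bounds the LOCAL control kernels at the additive places
`w ∣ 7d`, and removes the `θ`-binder:

* §1 `natCard_ker_eq_two_of_cmEndo` — ANY `π ∈ End_{K̄}(E_K)` with `π² = π − 2` (`j = −3375`) has `#ker π = #ker (1 − π) = 2` (it is
  `π₀` or `1 − π₀` for the base-changed `π₀` of `exists_cmEndo_baseChange`, in the commutative domain `End_{K̄}(E)`; standalone form
  of the inline step of -w2's `exists_eigen_pair_two`), and **`exists_sq_eq_neg_seven_of_cmEndo_mem_endRing`** — a `K`-RATIONAL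
  `π ∈ End_K(E_K)` with `π² = π − 2` forces `√−7 ∈ K` (-w8's `isSquare_neg_seven_of_cmEndo_equivariant`): every S3c₂ frame
  (`∀ K … ∀ π : End_K(E_K) …`) carries `θ : K` with `θ² = −7`, so the `hθ` binder of the `CMPrimes` / `…TowerTorsionSharp` theorems
  is DISCHARGED from the frame's own data (§3: `…_of_frame` corollaries with no `θ`).
* §2 ENGINE `two_nsmul_eq_zero_of_fixed_of_natCard_le_four` — for ANY subgroup `S ≤ Γ_K` whose fixed subgroup `F = E[2^∞]^S` is
  finite with `#F ≤ 4`, every `S`-fixed point of `E[𝔮_r^∞]` is `2`-torsion: `F` contains the (`Γ_K`-fixed) point `g′` of order `2`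
  of the OTHER summand `E[𝔮_{1−r}^∞]`; an `S`-fixed `x ∈ E[𝔮_r^∞]` of order `2^j`, `j ≥ 2`, gives `ℤx ≤ F` with `2^j ∣ #F ≤ 4`, so
  `F = ℤx ≤ E[𝔮_r^∞]` and `g′ ∈ E[𝔮_r^∞] ⊓ E[𝔮_{1−r}^∞] = ⊥` — absurd. Hence `natCard_fixedPoints_eq_two_of_natCard_le_four`
  (`#(E[𝔮_r^∞])^S = 2`) and `smul_eq_self_of_mem_fixedPoints_of_natCard_le_four` (ALL of `Γ_K` acts trivially on `(E[𝔮_r^∞])^S`).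
  (The LEAD's p656507 is the case `S = ker κ'` by a product injection; the engine here is for arbitrary `S`.)
* §3 INERTIA: **`natCard_fixedPoints_inertia_eq_two_of_hasAdditiveReductionAt`** — `#(E[𝔮_r^∞])^{I_w} = 2` at EVERY additive
  place `w ∤ 2` of `K` (`S = GreenbergSelmer.inertia w`, Greenberg's `c_w ≤ 4` = LEAD's p656082 transported to the `Subgroup`
  currency, `finite_and_natCard_fixedPoints_inertia_geomPrimaryTorsion_le_four`); for road α the places above `7`
  (`natCard_fixedPoints_inertia_seven_of_frame_eq_two`) and above the odd `ℓ ∣ d`. Since `I_w ≤ ker κ' ⊓ D_w` (`κ'` unramified at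
  `w`), the local control kernel `ker(H¹(D_w, W*) → H¹(ker κ' ⊓ D_w, W*))` lives in `H¹(D_w/I_w, W*[2])`-sized groups: at most ONE
  factor `2` per place `w ∣ 7d` of `K` — the «one unit per prime of `K` above `ℓ ∣ d`» of the S3c₂ docstring (file 2 of B16).
  ROAD α corollaries WITHOUT `θ`: `natCard_fixedPoints_kerSubgroup_eq_two_of_frame`, `smul_eq_self_of_mem_fixedPoints_kerSubgroup_of_frame`,
  `range_subOne_of_frame_eq_bot`, `natCard_ker_control_le_two_of_frame` (`v₂ #ker(control) ≤ 1` on the frame exactly as S3c₂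
  quantifies it).
presearch: Greenberg LNM 1716 §3 Lemma 3.3 (p. 88), Agboola 2007 §3 Prop. 3.2, Rubin LNM 1716 Prop. 5.4 — held; corpus+galaxy: no printed
sharp value at an additive prime (a two-line consequence of `c_v ≤ 4` and the CM splitting). beyond-print theorem: no.
References: [GreenbergLNM1716] §3 Lemmas 3.1, 3.3; [Agboola2007] §3 Prop. 3.2; [Rubin1999] §2, Prop. 5.4; [SilvermanAEC2009] Cor. III.9.4,
Prop. X.1.4; [SilvermanATAEC1994] II §2 Thm. 2.2(b), Thm. IV.10.2(a); [Cox2013] §14.B.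
-/

noncomputable section

open scoped Classical

set_option linter.dupNamespace false
set_option autoImplicit false

open NumberField IsDedekindDomain Field WeierstrassCurve
open Literature.NumberTheory.EllipticCurves Literature.NumberTheory.EllipticCurves.GreenbergSelmer
open Literature.NumberTheory.EllipticCurves.Agboola2007
open Literature.NumberTheory.EllipticCurves.IwasawaDual
open Literature.NumberTheory.EllipticCurves.ResKernel
open Literature.NumberTheory.GaloisRepresentations
open Summit.BirchSwinnertonDyer.BirchSwinnertonDyer.Theorems.PrintCf2.CMPrimes

universe u

namespace Summit.BirchSwinnertonDyer.BirchSwinnertonDyer.Theorems.PrintCf2.RestrictedSelmerPair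

/-! ## §1. A `K`-rational CM endomorphism `π` (`π² = π − 2`) forces `√−7 ∈ K` -/

section SqrtMinusSeven

variable (W : WeierstrassCurve ℚ) [W.IsElliptic] (K : Type) [Field K] [NumberField K]

/-- **`#ker π = #ker (1 − π) = 2` for EVERY geometric `π` with `π² = π − 2`** (`j(W) = −3375`, any number field `K`): in the
commutative domain `End_{K̄}(E_K)` the given `π` is a root of `(X − π₀)(X − (1 − π₀))`, `π₀` the base-changed CM endomorphism of
`exists_cmEndo_baseChange` (whose kernels have order `2`), so `π ∈ {π₀, 1 − π₀}`. Standalone form of the inline step of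
`CMPrimes.exists_eigen_pair_two`. [cite: SilvermanAEC2009, Cor. III.9.4] [cite: Cox2013, §14.B and Prop. 14.9] -/
theorem natCard_ker_eq_two_of_cmEndo (hj : W.j = -3375) {π : AddMonoid.End (W.baseChange K).geomPoints}
    (hπ : π ∈ (W.baseChange K).geomEndRing) (hrel : π * π = π - 2) :
    Nat.card (π : (W.baseChange K).geomPoints →+ (W.baseChange K).geomPoints).ker = 2 ∧
      Nat.card ((1 - π : AddMonoid.End (W.baseChange K).geomPoints) :
        (W.baseChange K).geomPoints →+ (W.baseChange K).geomPoints).ker = 2 := by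
  haveI : (W.baseChange K).IsElliptic := by rw [baseChange]; infer_instance
  obtain ⟨π₀, hπ₀, hrel₀, hk₀, hk₀'⟩ := exists_cmEndo_baseChange W hj K
  haveI := isDomain_geomEndRing (W.baseChange K)
  letI : CommRing (W.baseChange K).geomEndRing :=
    { (inferInstance : Ring (W.baseChange K).geomEndRing) with
      mul_comm := fun x y ↦ Subtype.ext ((W.baseChange K).geomEndRing_comm_holds _ _ x.2 y.2) }
  set x : (W.baseChange K).geomEndRing := ⟨π, hπ⟩ with hx_def
  set y : (W.baseChange K).geomEndRing := ⟨π₀, hπ₀⟩ with hy_def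
  have hx : x * x = x - 2 := Subtype.ext (by push_cast; exact hrel)
  have hy : y * y = y - 2 := Subtype.ext (by push_cast; exact hrel₀)
  have hxy : (x - y) * (x - (1 - y)) = 0 := by linear_combination hx - hy
  rcases mul_eq_zero.mp hxy with h | h
  · have hππ₀ : π = π₀ := congrArg Subtype.val (sub_eq_zero.mp h)
    rw [hππ₀]
    exact ⟨hk₀, hk₀'⟩
  · have h1 : π = 1 - π₀ := by simpa using congrArg Subtype.val (sub_eq_zero.mp h)
    have h2 : (1 - π : AddMonoid.End (W.baseChange K).geomPoints) = π₀ := by rw [h1, sub_sub_cancel]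
    refine ⟨?_, ?_⟩
    · rw [h1]; exact hk₀'
    · rw [h2]; exact hk₀

/-- **A `K`-RATIONAL CM ENDOMORPHISM PINS `K ∋ √−7`.** If `W/ℚ` has `j = −3375` and `π ∈ End_K(E_K)` (the tree's
`(W.baseChange K).endRing`: geometric AND `Γ_K`-equivariant) satisfies `π² = π − 2`, then `θ² = −7` for some `θ : K` — the
`2`-torsion rigidity of -w8's `isSquare_neg_seven_of_cmEndo_equivariant` fed with §1's kernel counts. So every S3c₂ frame
(`∀ K … ∀ π : End_K(E_K), π² = π − 2 → …`) carries the `θ` that the `CMPrimes` structure theorems take as a binder.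
[cite: SilvermanAEC2009, Prop. X.1.4 and Cor. III.9.4] [cite: SilvermanATAEC1994, II §2 Thm. 2.2(b)] -/
theorem exists_sq_eq_neg_seven_of_cmEndo_mem_endRing (hj : W.j = -3375) (π : (W.baseChange K).endRing)
    (hrel : (π : AddMonoid.End (W.baseChange K).geomPoints) * π = π - 2) : ∃ θ : K, θ ^ 2 = -7 := by
  obtain ⟨hπg, hπe⟩ := Subring.mem_inf.1 π.2
  obtain ⟨hker, hker'⟩ := natCard_ker_eq_two_of_cmEndo W K hj hπg hrel
  have hπG : ∀ (σ : absoluteGaloisGroup K) (P : (W.baseChange K).geomPoints),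
      (π : AddMonoid.End (W.baseChange K).geomPoints) (σ • P) =
        σ • (π : AddMonoid.End (W.baseChange K).geomPoints) P :=
    ((W.baseChange K).mem_equivariantSubring_iff _).1 hπe
  obtain ⟨θ, hθ⟩ := isSquare_neg_seven_of_cmEndo_equivariant W K hj hrel hker hker' hπG
  exact ⟨θ, by rw [sq]; exact hθ.symm⟩

end SqrtMinusSeven

/-! ## §2. ENGINE: a fixed subgroup of `E[2^∞]` of order `≤ 4` meets `E[𝔮_r^∞]` in `E[𝔮_r^∞][2]` -/

section Engine

variable (W : WeierstrassCurve ℚ) [W.IsElliptic] (K : Type) [Field K] [NumberField K]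

/-- `1 − r` is the other root of `X² − X + 2`. [folklore] -/
theorem one_sub_mul_one_sub_eq {r : ℤ_[2]} (hr : r * r = r - 2) : (1 - r) * (1 - r) = (1 - r) - 2 := by
  linear_combination hr

/-- **ENGINE.** `W/ℚ` elliptic with `j = −3375`, `K` a number field with `θ² = −7`, `π ∈ End_K(E_K)` with `π² = π − 2`,
`r² = r − 2`, and `S ≤ Γ_K` ANY subgroup whose fixed subgroup `F = E[2^∞]^S` is finite of order `≤ 4`. Then every `S`-fixed
point `x` of `E[𝔮_r^∞] = (W.baseChange K).endEigenPrimaryTorsion 2 π r` satisfies `2x = 0`. Proof: `F ∋ g′`, the point of order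
`2` of `E[𝔮_{1−r}^∞]` (fixed by all of `Γ_K`, -w2's `smul_eq_self_of_two_nsmul_eq_zero`); if `x` had order `2^j` with `j ≥ 2` then
`ℤx ≤ F`, `2^j ∣ #F ≤ 4` forces `F = ℤx ≤ E[𝔮_r^∞]`, so `g′ ∈ E[𝔮_r^∞] ⊓ E[𝔮_{1−r}^∞] = ⊥`
(`endEigenPrimaryTorsion_two_structure`) — absurd. [cite: GreenbergLNM1716, §3 Lemma 3.3 (p. 88)] [cite: Rubin1999, §2 and Prop. 5.4] -/
theorem two_nsmul_eq_zero_of_fixed_of_natCard_le_four (hj : W.j = -3375) {θ : K} (hθ : θ ^ 2 = -7)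
    (π : (W.baseChange K).endRing) (hrel : (π : AddMonoid.End (W.baseChange K).geomPoints) * π = π - 2)
    {r : ℤ_[2]} (hr : r * r = r - 2) (S : Subgroup (absoluteGaloisGroup K))
    [Finite (FixedPoints.addSubgroup S ((W.baseChange K).geomPrimaryTorsion 2))]
    (h4 : Nat.card (FixedPoints.addSubgroup S ((W.baseChange K).geomPrimaryTorsion 2)) ≤ 4)
    {x : (W.baseChange K).geomPrimaryTorsion 2} (hx : x ∈ (W.baseChange K).endEigenPrimaryTorsion 2 π r)
    (hfix : ∀ s ∈ S, s • x = x) : 2 • x = 0 := by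
  set F := FixedPoints.addSubgroup S ((W.baseChange K).geomPrimaryTorsion 2) with hF_def
  set M := (W.baseChange K).endEigenPrimaryTorsion 2 π r with hM_def
  set M' := (W.baseChange K).endEigenPrimaryTorsion 2 π (1 - r) with hM'_def
  obtain ⟨hinf, -, -, -, -, -, -, -⟩ := endEigenPrimaryTorsion_two_structure W hj K hθ π hrel hr
  have hr' : (1 - r) * (1 - r) = (1 - r) - 2 := one_sub_mul_one_sub_eq hr
  obtain ⟨-, -, -, -, -, -, hgen', -⟩ := endEigenPrimaryTorsion_two_structure W hj K hθ π hrel hr'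
  obtain ⟨g', hg'M', hord', -⟩ := hgen' 1
  rw [pow_one] at hord'
  have h2g' : 2 • g' = 0 := by
    have h := addOrderOf_nsmul_eq_zero g'
    rwa [hord'] at h
  -- `g′ ∈ F` and `x ∈ F`
  have hg'F : g' ∈ F := (FixedPoints.mem_addSubgroup _ _ g').mpr fun s ↦
    smul_eq_self_of_two_nsmul_eq_zero W hj hθ π hrel hr' (s : absoluteGaloisGroup K) hg'M' h2g'
  have hxF : x ∈ F := (FixedPoints.mem_addSubgroup _ _ x).mpr fun s ↦ hfix (s : absoluteGaloisGroup K) s.2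
  by_contra h2x
  -- the order of `x` is `2^j` with `j ≥ 2`
  obtain ⟨m, hm⟩ : ∃ m : ℕ, 2 ^ m • x = 0 := by
    obtain ⟨m, hm⟩ := (AddCommGroup.mem_primaryComponent).mp x.2
    exact ⟨m, Subtype.ext (by rw [AddSubmonoidClass.coe_nsmul, ZeroMemClass.coe_zero]; exact hm)⟩
  obtain ⟨j, -, hj'⟩ := (Nat.dvd_prime_pow Nat.prime_two).mp (addOrderOf_dvd_of_nsmul_eq_zero hm)
  have hj2 : 2 ≤ j := by
    by_contra hlt
    have hdvd : addOrderOf x ∣ 2 := by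
      rw [hj']
      calc 2 ^ j ∣ 2 ^ 1 := Nat.pow_dvd_pow 2 (by omega)
        _ = 2 := pow_one 2
    exact h2x (addOrderOf_dvd_iff_nsmul_eq_zero.mp hdvd)
  have hle : AddSubgroup.zmultiples x ≤ F := AddSubgroup.zmultiples_le_of_mem hxF
  have hcardx : Nat.card (AddSubgroup.zmultiples x) = 2 ^ j := by rw [Nat.card_zmultiples, hj']
  have hdvd : 2 ^ j ∣ Nat.card F := hcardx ▸ AddSubgroup.card_dvd_of_le hle
  have hFpos : 0 < Nat.card F := Nat.card_pos
  have h4j : 4 ≤ 2 ^ j :=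
    calc (4 : ℕ) = 2 ^ 2 := by norm_num
      _ ≤ 2 ^ j := Nat.pow_le_pow_right (by norm_num) hj2
  have hFeq : Nat.card F = Nat.card (AddSubgroup.zmultiples x) := by
    rw [hcardx]
    exact le_antisymm (h4.trans h4j) (Nat.le_of_dvd hFpos hdvd)
  have hFx : AddSubgroup.zmultiples x = F := AddSubgroup.eq_of_le_of_card_ge hle (le_of_eq hFeq)
  -- hence `g′ ∈ ℤx ≤ E[𝔮_r^∞]`, contradicting `E[𝔮_r^∞] ⊓ E[𝔮_{1−r}^∞] = ⊥`
  have hg'M : g' ∈ M := by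
    have hg'x : g' ∈ AddSubgroup.zmultiples x := by rw [hFx]; exact hg'F
    exact AddSubgroup.zmultiples_le_of_mem hx hg'x
  have hbot : g' ∈ M ⊓ M' := ⟨hg'M, hg'M'⟩
  rw [hinf, AddSubgroup.mem_bot] at hbot
  rw [hbot, addOrderOf_zero] at hord'
  exact absurd hord' (by norm_num)

/-- **`#(E[𝔮_r^∞])^S = 2`** under the ENGINE's hypotheses: the `S`-fixed subgroup of the named module
`↥((W.baseChange K).endEigenPrimaryTorsion 2 π r)` is in bijection with `E[𝔮_r^∞][2]` (order `2`,
`endEigenPrimaryTorsion_two_structure`) — `⊆` by the ENGINE, `⊇` because every element of `Γ_K` fixes `E[𝔮_r^∞][2]`.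
[cite: GreenbergLNM1716, §3 Lemma 3.3 (p. 88)] [cite: Rubin1999, §2 and Prop. 5.4] -/
theorem natCard_fixedPoints_eq_two_of_natCard_le_four (hj : W.j = -3375) {θ : K} (hθ : θ ^ 2 = -7)
    (π : (W.baseChange K).endRing) (hrel : (π : AddMonoid.End (W.baseChange K).geomPoints) * π = π - 2)
    {r : ℤ_[2]} (hr : r * r = r - 2) (S : Subgroup (absoluteGaloisGroup K))
    [Finite (FixedPoints.addSubgroup S ((W.baseChange K).geomPrimaryTorsion 2))]
    (h4 : Nat.card (FixedPoints.addSubgroup S ((W.baseChange K).geomPrimaryTorsion 2)) ≤ 4) :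
    Nat.card (FixedPoints.addSubgroup S ↥((W.baseChange K).endEigenPrimaryTorsion 2 π r)) = 2 := by
  obtain ⟨-, -, -, -, -, hcard, -, -⟩ := endEigenPrimaryTorsion_two_structure W hj K hθ π hrel hr
  -- every `S`-fixed element of the named module is `2`-torsion (ENGINE)
  have htwo : ∀ y : ↥((W.baseChange K).endEigenPrimaryTorsion 2 π r),
      y ∈ FixedPoints.addSubgroup S ↥((W.baseChange K).endEigenPrimaryTorsion 2 π r) →
        2 • (y : (W.baseChange K).geomPrimaryTorsion 2) = 0 := fun y hy ↦
    two_nsmul_eq_zero_of_fixed_of_natCard_le_four W K hj hθ π hrel hr S h4 y.2 (fun s hs ↦ by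
      have h := hy ⟨s, hs⟩
      rw [Subgroup.mk_smul] at h
      have h' := congrArg (fun z : ↥((W.baseChange K).endEigenPrimaryTorsion 2 π r) ↦
        (z : (W.baseChange K).geomPrimaryTorsion 2)) h
      simpa only [endEigenPrimaryTorsion.coe_smul] using h')
  -- the comparison map to `E[𝔮_r^∞][2] = E[𝔮_r^∞] ⊓ E[2^∞][2]`
  let f : FixedPoints.addSubgroup S ↥((W.baseChange K).endEigenPrimaryTorsion 2 π r) →
      ↥((W.baseChange K).endEigenPrimaryTorsion 2 π r ⊓
        AddSubgroup.torsionBy ((W.baseChange K).geomPrimaryTorsion 2) (2 ^ 1 : ℕ)) :=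
    fun y ↦ ⟨((y : ↥((W.baseChange K).endEigenPrimaryTorsion 2 π r)) : (W.baseChange K).geomPrimaryTorsion 2),
      ⟨(y : ↥((W.baseChange K).endEigenPrimaryTorsion 2 π r)).2,
        AddSubgroup.torsionBy.nsmul_iff.mpr
          ((congrArg (fun n : ℕ ↦ n • ((y : ↥((W.baseChange K).endEigenPrimaryTorsion 2 π r)) :
            (W.baseChange K).geomPrimaryTorsion 2)) (pow_one 2)).trans (htwo y y.2))⟩⟩
  have hf : Function.Bijective f := by
    refine ⟨fun a b hab ↦ ?_, fun z ↦ ?_⟩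
    · have h1 := congrArg Subtype.val hab
      exact Subtype.ext (Subtype.ext h1)
    · have hzM : (z : (W.baseChange K).geomPrimaryTorsion 2) ∈ (W.baseChange K).endEigenPrimaryTorsion 2 π r :=
        (AddSubgroup.mem_inf.mp z.2).1
      have hz2 : 2 • (z : (W.baseChange K).geomPrimaryTorsion 2) = 0 :=
        (congrArg (fun n : ℕ ↦ n • (z : (W.baseChange K).geomPrimaryTorsion 2)) (pow_one 2)).symm.trans
          (AddSubgroup.torsionBy.nsmul_iff.mp (AddSubgroup.mem_inf.mp z.2).2)
      refine ⟨⟨⟨(z : (W.baseChange K).geomPrimaryTorsion 2), hzM⟩,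
        (FixedPoints.mem_addSubgroup _ _ _).mpr fun s ↦ Subtype.ext ?_⟩, rfl⟩
      rw [Subgroup.smul_def, endEigenPrimaryTorsion.coe_smul]
      exact smul_eq_self_of_two_nsmul_eq_zero W hj hθ π hrel hr (s : absoluteGaloisGroup K) hzM hz2
  rw [Nat.card_congr (Equiv.ofBijective f hf), hcard 1, pow_one]

/-- **Every element of `Γ_K` acts trivially on `(E[𝔮_r^∞])^S`** under the ENGINE's hypotheses (the fixed module is
`E[𝔮_r^∞][2]`, on which `Γ_K` acts trivially). [cite: Rubin1999, §2 and Prop. 5.4] -/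
theorem smul_eq_self_of_mem_fixedPoints_of_natCard_le_four (hj : W.j = -3375) {θ : K} (hθ : θ ^ 2 = -7)
    (π : (W.baseChange K).endRing) (hrel : (π : AddMonoid.End (W.baseChange K).geomPoints) * π = π - 2)
    {r : ℤ_[2]} (hr : r * r = r - 2) (S : Subgroup (absoluteGaloisGroup K))
    [Finite (FixedPoints.addSubgroup S ((W.baseChange K).geomPrimaryTorsion 2))]
    (h4 : Nat.card (FixedPoints.addSubgroup S ((W.baseChange K).geomPrimaryTorsion 2)) ≤ 4)
    {y : ↥((W.baseChange K).endEigenPrimaryTorsion 2 π r)}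
    (hy : y ∈ FixedPoints.addSubgroup S ↥((W.baseChange K).endEigenPrimaryTorsion 2 π r))
    (g : absoluteGaloisGroup K) : g • y = y := by
  have h2 : 2 • (y : (W.baseChange K).geomPrimaryTorsion 2) = 0 :=
    two_nsmul_eq_zero_of_fixed_of_natCard_le_four W K hj hθ π hrel hr S h4 y.2 (fun s hs ↦ by
      have h := hy ⟨s, hs⟩
      rw [Subgroup.mk_smul] at h
      have h' := congrArg (fun z : ↥((W.baseChange K).endEigenPrimaryTorsion 2 π r) ↦
        (z : (W.baseChange K).geomPrimaryTorsion 2)) h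
      simpa only [endEigenPrimaryTorsion.coe_smul] using h')
  refine Subtype.ext ?_
  rw [endEigenPrimaryTorsion.coe_smul]
  exact smul_eq_self_of_two_nsmul_eq_zero W hj hθ π hrel hr g y.2 h2

end Engine

/-! ## §3. The INERTIA form at an additive place `w ∤ 2`, and road α's S3c₂ frames -/

section Inertia

variable (W : WeierstrassCurve ℚ) [W.IsElliptic] (K : Type) [Field K] [NumberField K]

/-- The LEAD's `I_w`-fixed subtype and `FixedPoints.addSubgroup (GreenbergSelmer.inertia w) E[p^∞]` are the same set
(`inertia w` is the image of `absInertia K_w` under `absGaloisRestrict K K_w`). [cite: Greenberg1989, §1 p. 98] -/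
theorem finite_and_natCard_fixedPoints_inertia_geomPrimaryTorsion_le_four {L : Type u} [Field L] [NumberField L]
    (V : WeierstrassCurve L) [V.IsElliptic] (p : ℕ) [Fact p.Prime] {w : HeightOneSpectrum (𝓞 L)}
    (hpw : ((p : ℕ) : 𝓞 L) ∉ w.asIdeal) (hadd : V.HasAdditiveReductionAt w) :
    Finite (FixedPoints.addSubgroup (GreenbergSelmer.inertia w) (V.geomPrimaryTorsion p)) ∧
      Nat.card (FixedPoints.addSubgroup (GreenbergSelmer.inertia w) (V.geomPrimaryTorsion p)) ≤ 4 := by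
  obtain ⟨hfin, hle⟩ := finite_and_natCard_absInertia_fixed_geomPrimaryTorsion_le_four V p hpw hadd
  haveI := hfin
  let g : FixedPoints.addSubgroup (GreenbergSelmer.inertia w) (V.geomPrimaryTorsion p) →
      {P : V.geomPrimaryTorsion p //
        ∀ σ ∈ absInertia (w.adicCompletion L), absGaloisRestrict L (w.adicCompletion L) σ • (P : geomPoints V) = P} :=
    fun x ↦ ⟨(x : V.geomPrimaryTorsion p), fun σ hσ ↦ by
      have hmem : absGaloisRestrict L (w.adicCompletion L) σ ∈ GreenbergSelmer.inertia w :=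
        Subgroup.mem_map.mpr ⟨σ, hσ, rfl⟩
      have h := x.2 ⟨_, hmem⟩
      rw [Subgroup.mk_smul] at h
      have h' := congrArg (fun y : V.geomPrimaryTorsion p ↦ (y : geomPoints V)) h
      simpa only [primaryComponent.coe_smul] using h'⟩
  have hg : Function.Injective g := fun a b hab ↦ by
    have h1 := congrArg Subtype.val hab
    exact Subtype.ext h1
  exact ⟨Finite.of_injective g hg, (Nat.card_le_card_of_injective g hg).trans hle⟩

/-- **`#(E[𝔮_r^∞])^{I_w} = 2` at every ADDITIVE place `w ∤ 2`** (`j = −3375`, `θ² = −7`, `π ∈ End_K(E_K)`, `π² = π − 2`,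
`r² = r − 2`): Greenberg's `c_w ≤ 4` on `E[2^∞]` (LEAD g11, global currency) run through the ENGINE. For road α: the places of
`K = ℚ(√−7)` above `7` and above the odd primes `ℓ ∣ d` — the local control kernels at `w ∣ 7d` live in quotients of this group
of order `2`. [cite: GreenbergLNM1716, §3 Lemma 3.3 (p. 88)] [cite: Agboola2007, §3 Prop. 3.2] -/
theorem natCard_fixedPoints_inertia_eq_two_of_hasAdditiveReductionAt (hj : W.j = -3375) {θ : K} (hθ : θ ^ 2 = -7)
    (π : (W.baseChange K).endRing) (hrel : (π : AddMonoid.End (W.baseChange K).geomPoints) * π = π - 2)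
    {r : ℤ_[2]} (hr : r * r = r - 2) {w : HeightOneSpectrum (𝓞 K)} (h2w : ((2 : ℕ) : 𝓞 K) ∉ w.asIdeal)
    (hadd : (W.baseChange K).HasAdditiveReductionAt w) :
    Nat.card (FixedPoints.addSubgroup (GreenbergSelmer.inertia w)
      ↥((W.baseChange K).endEigenPrimaryTorsion 2 π r)) = 2 := by
  haveI : (W.baseChange K).IsElliptic := by rw [baseChange]; infer_instance
  obtain ⟨hfin, hle⟩ :=
    finite_and_natCard_fixedPoints_inertia_geomPrimaryTorsion_le_four (W.baseChange K) 2 h2w hadd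
  haveI := hfin
  exact natCard_fixedPoints_eq_two_of_natCard_le_four W K hj hθ π hrel hr (GreenbergSelmer.inertia w) hle

end Inertia

section Frame

open Summit.BirchSwinnertonDyer.BirchSwinnertonDyer.Theorems.PrintCf2.AdditiveAtSeven

variable {K : Type} [Field K] [NumberField K]

/-- **Every S3c₂ frame carries `√−7 ∈ K`** (member `C • W = cm7^{(d)}`, `π ∈ End_K(E_K)` with `π² = π − 2`): the `θ`-binder
of the LEAD's `…TowerTorsionSharp` theorems is a THEOREM of the frame. [cite: SilvermanAEC2009, Prop. X.1.4 and Cor. III.9.4] -/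
theorem exists_sq_eq_neg_seven_of_frame_cmEndo {d : ℤ} (hd0 : d ≠ 0) (W : WeierstrassCurve ℚ) [W.IsElliptic]
    (C : VariableChange ℚ) (hC : C • W = cm7.quadraticTwist (d : ℚ))
    (π : (W.baseChange K).endRing) (hrel : (π : AddMonoid.End (W.baseChange K).geomPoints) * π = π - 2) :
    ∃ θ : K, θ ^ 2 = -7 :=
  exists_sq_eq_neg_seven_of_cmEndo_mem_endRing W K (j_eq_of_smul_eq_cm7Twist hd0 W C hC) π hrel

/-- **`#W*(K*_∞) = 2` on every S3c₂ frame, with NO `θ`-binder** (the frame exactly as S3c₂ quantifies it: member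
`C • W = cm7^{(d)}`, `K` imaginary quadratic, `v̄ ∣ 2`, `π ∈ End_K(E_K)` with `π² = π − 2`, `r² = r − 2`, `κ'` unramified outside
`v̄`): the LEAD's `natCard_fixedPoints_kerSubgroup_of_frame_eq_two` (p656507) fed with `exists_sq_eq_neg_seven_of_frame_cmEndo`.
[cite: Agboola2007, §3 Prop. 3.2 (arXiv p0008:L128–135)] [cite: GreenbergLNM1716, §3 Lemma 3.3 (p. 88)] -/
theorem natCard_fixedPoints_kerSubgroup_eq_two_of_frame {d : ℤ} (hd0 : d ≠ 0) (W : WeierstrassCurve ℚ) [W.IsElliptic]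
    (C : VariableChange ℚ) (hC : C • W = cm7.quadraticTwist (d : ℚ)) (hK : IsImaginaryQuadratic K)
    (vbar : HeightOneSpectrum (𝓞 K)) (hvbar : ((2 : ℕ) : 𝓞 K) ∈ vbar.asIdeal)
    (π : (W.baseChange K).endRing) (hrel : (π : AddMonoid.End (W.baseChange K).geomPoints) * π = π - 2)
    {r : ℤ_[2]} (hr : r * r = r - 2) (κ' : ZpExtension K 2) (hκ' : κ'.IsUnramifiedOutside vbar) :
    Nat.card (FixedPoints.addSubgroup κ'.kerSubgroup ↥((W.baseChange K).endEigenPrimaryTorsion 2 π r)) = 2 := by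
  obtain ⟨θ, hθ⟩ := exists_sq_eq_neg_seven_of_frame_cmEndo hd0 W C hC π hrel
  exact natCard_fixedPoints_kerSubgroup_of_frame_eq_two hd0 W C hC hK hθ vbar hvbar π hrel hr κ' hκ'

/-- **`Γ_K` acts trivially on `W*(K*_∞)`** on every S3c₂ frame, no `θ`-binder (the fixed module is `W*[2]`): in particular
`γ' − 1 = 0` on `W*(K*_∞)` and `H¹(Γ, W*(K*_∞)) = Hom(Γ, W*[2])`. [cite: GreenbergLNM1716, §3 Lemma 3.1] [cite: Rubin1999, §2 and Prop. 5.4] -/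
theorem smul_eq_self_of_mem_fixedPoints_kerSubgroup_of_frame {d : ℤ} (hd0 : d ≠ 0) (W : WeierstrassCurve ℚ) [W.IsElliptic]
    (C : VariableChange ℚ) (hC : C • W = cm7.quadraticTwist (d : ℚ)) (hK : IsImaginaryQuadratic K)
    (vbar : HeightOneSpectrum (𝓞 K)) (hvbar : ((2 : ℕ) : 𝓞 K) ∈ vbar.asIdeal)
    (π : (W.baseChange K).endRing) (hrel : (π : AddMonoid.End (W.baseChange K).geomPoints) * π = π - 2)
    {r : ℤ_[2]} (hr : r * r = r - 2) (κ' : ZpExtension K 2) (hκ' : κ'.IsUnramifiedOutside vbar)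
    (g : absoluteGaloisGroup K)
    (y : FixedPoints.addSubgroup κ'.kerSubgroup ↥((W.baseChange K).endEigenPrimaryTorsion 2 π r)) :
    g • (y : ↥((W.baseChange K).endEigenPrimaryTorsion 2 π r)) = y := by
  obtain ⟨θ, hθ⟩ := exists_sq_eq_neg_seven_of_frame_cmEndo hd0 W C hC π hrel
  exact smul_eq_self_of_mem_fixedPoints_of_frame hd0 W C hC hK hθ vbar hvbar π hrel hr κ' hκ' g y

/-- **`γ' − 1` VANISHES on `W*(K*_∞)`**: the range of `subOne (ker κ') W* γ'` is `⊥` (no `θ`-binder), so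
`W*(K*_∞) ⧸ (γ' − 1) = W*(K*_∞)` has order `2` on every S3c₂ frame. [cite: GreenbergLNM1716, §3 Lemma 3.1] -/
theorem range_subOne_of_frame_eq_bot {d : ℤ} (hd0 : d ≠ 0) (W : WeierstrassCurve ℚ) [W.IsElliptic]
    (C : VariableChange ℚ) (hC : C • W = cm7.quadraticTwist (d : ℚ)) (hK : IsImaginaryQuadratic K)
    (vbar : HeightOneSpectrum (𝓞 K)) (hvbar : ((2 : ℕ) : 𝓞 K) ∈ vbar.asIdeal)
    (π : (W.baseChange K).endRing) (hrel : (π : AddMonoid.End (W.baseChange K).geomPoints) * π = π - 2)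
    {r : ℤ_[2]} (hr : r * r = r - 2) (κ' : ZpExtension K 2) (hκ' : κ'.IsUnramifiedOutside vbar)
    (γ' : absoluteGaloisGroup K) :
    (subOne κ'.kerSubgroup ↥((W.baseChange K).endEigenPrimaryTorsion 2 π r) γ').range = ⊥ := by
  rw [eq_bot_iff]
  rintro _ ⟨y, rfl⟩
  rw [AddSubgroup.mem_bot]
  refine Subtype.ext ?_
  rw [coe_subOne_apply, ZeroMemClass.coe_zero, sub_eq_zero]
  exact smul_eq_self_of_mem_fixedPoints_kerSubgroup_of_frame hd0 W C hC hK vbar hvbar π hrel hr κ' hκ' γ' y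

/-- **THE KERNEL TERM OF THE FOUR-INDEX IDENTITY IS `0` OR `1`, with NO `θ`-binder**: for the bottom control map
`res : 𝔖_{v̄}(K, W*) → 𝔖_{v̄}(K*_∞, W*)` (B5′/B5‴ currency), `#ker ≤ 2` and `v₂ #ker ≤ 1` on EVERY S3c₂ frame as quantified by the
stub (the LEAD's `natCard_ker_control_of_frame_le_two`, p656507, fed with `exists_sq_eq_neg_seven_of_frame_cmEndo`).
[cite: Agboola2007, §3 Prop. 3.2 (arXiv p0008:L128–135, L197)] [cite: GreenbergLNM1716, §3 Lemmas 3.1 and 3.3] -/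
theorem natCard_ker_control_le_two_of_frame {d : ℤ} (hd0 : d ≠ 0) (W : WeierstrassCurve ℚ) [W.IsElliptic]
    (C : VariableChange ℚ) (hC : C • W = cm7.quadraticTwist (d : ℚ)) (hK : IsImaginaryQuadratic K)
    (vbar : HeightOneSpectrum (𝓞 K)) (hvbar : ((2 : ℕ) : 𝓞 K) ∈ vbar.asIdeal)
    (π : (W.baseChange K).endRing) (hrel : (π : AddMonoid.End (W.baseChange K).geomPoints) * π = π - 2)
    {r : ℤ_[2]} (hr : r * r = r - 2) (κ' : ZpExtension K 2) (hκ' : κ'.IsUnramifiedOutside vbar)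
    {γ' : absoluteGaloisGroup K} (hγ' : κ'.IsTopGenerator γ') :
    Nat.card ↥(restrictedSelmerBase ↥((W.baseChange K).endEigenPrimaryTorsion 2 π r) 2 vbar ⊓
        (resOfLe ↥((W.baseChange K).endEigenPrimaryTorsion 2 π r) (le_top : κ'.kerSubgroup ≤ ⊤)).ker) ≤ 2 ∧
      padicValNat 2 (Nat.card ↥(restrictedSelmerBase ↥((W.baseChange K).endEigenPrimaryTorsion 2 π r) 2 vbar ⊓
        (resOfLe ↥((W.baseChange K).endEigenPrimaryTorsion 2 π r) (le_top : κ'.kerSubgroup ≤ ⊤)).ker)) ≤ 1 := by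
  obtain ⟨θ, hθ⟩ := exists_sq_eq_neg_seven_of_frame_cmEndo hd0 W C hC π hrel
  exact natCard_ker_control_of_frame_le_two hd0 W C hC hK hθ vbar hvbar π hrel hr κ' hκ' hγ'

/-- **`#(E[𝔮_r^∞])^{I_{w₇}} = 2` at the place above `7`** on every S3c₂ frame (no `θ`-binder): the local input at `w ∣ 7`
for the control cokernel — `W*(K*_{∞,η}) ⊆ W*^{I_{w₇}} = W*[2]`. [cite: GreenbergLNM1716, §3 Lemma 3.3 (p. 88)] [cite: Agboola2007, §3 Prop. 3.2] -/
theorem natCard_fixedPoints_inertia_seven_of_frame_eq_two {d : ℤ} (hd0 : d ≠ 0) (W : WeierstrassCurve ℚ) [W.IsElliptic]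
    (C : VariableChange ℚ) (hC : C • W = cm7.quadraticTwist (d : ℚ)) (hK : IsImaginaryQuadratic K)
    (π : (W.baseChange K).endRing) (hrel : (π : AddMonoid.End (W.baseChange K).geomPoints) * π = π - 2)
    {r : ℤ_[2]} (hr : r * r = r - 2) {w : HeightOneSpectrum (𝓞 K)} (h7 : ((7 : ℕ) : 𝓞 K) ∈ w.asIdeal) :
    Nat.card (FixedPoints.addSubgroup (GreenbergSelmer.inertia w)
      ↥((W.baseChange K).endEigenPrimaryTorsion 2 π r)) = 2 := by
  have hj : W.j = -3375 := j_eq_of_smul_eq_cm7Twist hd0 W C hC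
  obtain ⟨θ, hθ⟩ := exists_sq_eq_neg_seven_of_cmEndo_mem_endRing W K hj π hrel
  haveI : (W.baseChange K).IsElliptic := by rw [baseChange]; infer_instance
  exact natCard_fixedPoints_inertia_eq_two_of_hasAdditiveReductionAt W K hj hθ π hrel hr
    (natCast_two_notMem_of_seven_mem w h7)
    (hasAdditiveReductionAt_baseChange_of_j_eq_cm7_of_finrank_eq_two K w hK.1 W hj h7)

end Frame

end Summit.BirchSwinnertonDyer.BirchSwinnertonDyer.Theorems.PrintCf2.RestrictedSelmerPair

end
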